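import Summits.HodgeConjecture.HodgeCM.Prior.Perl34_2

/-! PORT of `HodgeCM/Prior/Perl34.lean` (HodgeCMPerL run 81) — part 3: continuation of `Summits.HodgeConjecture.HodgeCM.Prior.Perl34_2` (split at a top-level declaration boundary by port_pkg.py; scope re-opened below; declarations unchanged). -/

-- port_pkg: scope re-opened for this part (file-level context, then the namespace/section stack open at the cut)
namespace HodgeCM.Prior.Perl34File
namespace Perl34
namespace C3a
/-- (no docstring in the 2001 source) -/
private theorem mem_aux (c ψ : Bool) (x : ℤ) (hx : x = if ψ then 1 else -1) :
    ((c = false ∧ x = -1) ∨ (c = true ∧ x = 1)) ↔ (c = ψ) := by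
  cases ψ <;> cases c <;> simp_all

/-- If m has the exponent pattern of Ψ then Φ′(m) is (the embedding set of) Ψ. -/
theorem Phiprime_eq_typeSet {B : Type} (Ψ : B → Bool) (m : B → ℤ)
    (h : ∀ b, m b = mOf Ψ b) : Phiprime m = typeSet Ψ := by
  ext ⟨b, c⟩
  simp only [Phiprime, typeSet, Set.mem_setOf_eq]
  exact mem_aux c (Ψ b) (m b) (h b)

/-- **The A-lemma of plan C3a** ([PerL] l. 296 with ll. 270–274, 98–100):
"μ‖·‖^{−1/2} of infinity type −Σ_{ρ∈Ψ}ρ" ⟺ the exponent pattern (eq:Phiprime)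
of m is Ψ.  (No {±1} hypothesis: the set equality itself forces m_b ∈ {±1},
place by place, so the lemma is stated in the strongest form.) -/
theorem inftyType_iff_Phiprime {B : Type} (Ψ : B → Bool) (m : B → ℤ) :
    (∀ b, InftyTypeAt Ψ m b) ↔ Phiprime m = typeSet Ψ := by
  rw [inftyType_iff_mOf]
  constructor
  · rintro rfl
    exact Phiprime_eq_typeSet Ψ _ fun _ => rfl
  · intro h
    funext b
    show m b = if Ψ b then 1 else -1
    cases hΨ : Ψ b
    · have hmem : (b, false) ∈ Phiprime m := by
        rw [h]; show (false : Bool) = Ψ b; exact hΨ.symm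
      rcases hmem with ⟨_, hm1⟩ | ⟨hc, _⟩
      · simpa using hm1
      · exact absurd hc (by simp)
    · have hmem : (b, true) ∈ Phiprime m := by
        rw [h]; show (true : Bool) = Ψ b; exact hΨ.symm
      rcases hmem with ⟨hc, _⟩ | ⟨_, hm1⟩
      · exact absurd hc (by simp)
      · simpa using hm1
/-! ## The AX2 character layer and the allowed-datum interface -/

/-- **AX2 layer** ([PerL] ll. 96–100 via [Y1neg] Lemma 4.1): a bare type of unitary
Hecke characters of L, their complex-place exponents m_b(·), a local-agreement
relation at the finite places, and the rigidity "read off the Satake parameters"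
(l. 96 `unique`): two characters agreeing at almost all finite places coincide.
`AlmostAll` is the abstract "at almost every finite place" collection (monotone;
the concrete cofinite filter stays semantic, D1). -/
structure CharLayer (B V : Type) where
  /-- unitary Hecke characters of L (bare index type). -/
  Char : Type
  /-- AX2: the exponents m_b(·) ∈ ℤ at the complex places (ll. 96–97; values in {±1}
  for the characters attached to 𝒜^{1,0}, carried where consumed). -/
  mExp : Char → B → ℤ
  /-- the set of finite places where two Hecke characters have equal unramified local
  components (equal Satake data). -/
  locEq : Char → Char → Set V
  /-- "at almost all finite places" (contains-a-cofinite-set collection; bare). -/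
  AlmostAll : Set V → Prop
  /-- monotonicity of `AlmostAll`. -/
  almostAll_mono : ∀ {s t : Set V}, s ⊆ t → AlmostAll s → AlmostAll t
  /-- AX2 rigidity: characters agreeing at almost all finite places are equal
  ("there is a unique unitary Hecke character μ(π) read off the Satake parameters",
  l. 96; [Y1neg] Lemma 4.1). -/
  AX2_rigid : ∀ χ χ' : Char, AlmostAll (locEq χ χ') → χ = χ'

/-- **One allowed datum** (W_i, μ_i, χ′_i) of type Ψ_i with the constituent layer of
the L²-closure of its theta space π_i = Θ^{W_i}_{μ_i}(χ′_i), at the plan's C3a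
abstraction (Def 3.2, ll. 269–279; proof of Lemma 3.3(a), ll. 288–296).  `iota1` is
the distinguished real place; signs are `Bool` (`true` = +). -/
structure AllowedDatum {B V : Type} (L : CharLayer B V) (Ψ : B → Bool) (iota1 : B) where
  /-- the splitting character μ_i of the datum. -/
  mu : L.Char
  /-- Def 3.2 (ll. 272–274): μ_i‖·‖^{−1/2} is algebraic of infinity type −Σ_{ρ∈Ψ_i}ρ. -/
  mu_infty : ∀ b, InftyTypeAt Ψ (L.mExp mu) b
  /-- irreducible constituents σ of the L²-closure of π_i (bare index type). -/
  Con : Type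
  /-- AX2 (l. 96): σ ↦ μ(σ), the unitary Hecke character read off σ's Satake data. -/
  muOf : Con → L.Char
  /-- AX3, base-independent step borrowed from the second proof of [Y1neg] Lemma 4.2
  (ll. 289–291, 92–94): the set of finite places where the local component σ_v is an
  unramified irreducible quotient of ω_v[χ̄′_{i,v}] (all data unramified there). -/
  UnramQuot : Con → Set V
  /-- AX3: that set contains almost all finite places ("at almost every place v all
  data are unramified and ...", l. 289). -/
  AX3_ae : ∀ σ, L.AlmostAll (UnramQuot σ)
  /-- AX4 (+ convention pin, ll. 291–296; Kudla, MVW Ch. 5; Gan–Ichino 1409.6824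
  Thm 4.4 / Atobe–Gan 1602.01299 Thm 4.3 + Prop 5.6, vendored): at such a place the
  spherical line is 1-dimensional and every unramified irreducible quotient carries
  the Satake parameter of the unramified Howe correspondent for (U(1),U(3)) with
  splitting μ_i — so μ(σ) and μ_i agree there. -/
  AX4_howe : ∀ σ, ∀ v ∈ UnramQuot σ, v ∈ L.locEq (muOf σ) mu
  /-- the real signs s_b(W_i) of the hermitian line W_i (`true` = +). -/
  sign : B → Bool
  /-- ε_hol, the holomorphy sign at ι₁ (l. 283–285). -/
  epsHol : Bool
  /-- AX3 ([Y1neg] Lemma 3.1(a); l. 283): allowedness forces s_{ι₁}(W_i) = ε_hol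
  (J⁺ occurs in the Fock model at ι₁ only for that sign). -/
  AX3_sign_iota1 : sign iota1 = epsHol
  /-- AX3 / A3(v) ([Y1neg] Lemma 3.2; S2's `mSign`): the dichotomy value m(s) — the
  exponent for which the U(3)-trivial type occurs in the Fock model of a line of
  sign s at b ≠ ι₁. -/
  mSign : Bool → ℤ
  /-- A3(v) model output (S2's `A3v_mSign_flip`): m(−s) = −m(s). -/
  mSign_flip : ∀ s, mSign (!s) = -(mSign s)
  /-- AX3 [A#3], the HKS pin (S2's `A3v_HKS`; NOT model output): |m(s)| = 1. -/
  mSign_unit : ∀ s, mSign s = 1 ∨ mSign s = -1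
  /-- AX3 occurrence (ll. 289–296 with [Y1neg] Lemma 3.2 and lem:arch(a), ll. 493–496):
  allowedness — θ(φ,χ′_i) ≠ 0 with all constituents of archimedean type J⁺⊗1 —
  forces, at each b ≠ ι₁, the trivial type to occur in the local Fock model of
  W_{i,b}, i.e. the dichotomy value of the sign of W_{i,b} to be the exponent
  m_b(μ_i). -/
  AX3_sign_forced : ∀ b, b ≠ iota1 → mSign (sign b) = L.mExp mu b

namespace AllowedDatum

variable {B V : Type} {L : CharLayer B V} {Ψ : B → Bool} {iota1 : B}
variable (A : AllowedDatum L Ψ iota1)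

/-- μ_i has the exponent pattern of Ψ_i (Def 3.2 through the A-lemma). -/
theorem mExp_mu_eq : L.mExp A.mu = mOf Ψ :=
  (inftyType_iff_mOf Ψ (L.mExp A.mu)).mp A.mu_infty
/-- The character step of Lemma 3.3(a) (ll. 289–296): μ(σ) = μ_i for every irreducible
constituent σ of the closure of π_i — AX3 (a.e. unramified quotient) + AX4 (Howe
Satake parameter) + AX2 (rigidity). -/
theorem muOf_eq (σ : A.Con) : A.muOf σ = A.mu :=
  L.AX2_rigid _ _ (L.almostAll_mono (fun v hv => A.AX4_howe σ v hv) (A.AX3_ae σ))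

/-- Constituent exponents: m_b(σ) = m_b(Ψ_i) at every complex place (the form C6's
(H2)/(H3) bookkeeping consumes). -/
theorem mExp_muOf (σ : A.Con) (b : B) : L.mExp (A.muOf σ) b = mOf Ψ b := by
  rw [A.muOf_eq σ, A.mExp_mu_eq]

/-- **Lemma 3.3(a), first clause** (ll. 281–283, 296): every irreducible constituent σ
of the closure of π_i has Φ′(σ) = Ψ_i. -/
theorem C3a_Phiprime (σ : A.Con) : Phiprime (L.mExp (A.muOf σ)) = typeSet Ψ := by
  rw [A.muOf_eq σ, A.mExp_mu_eq]
  exact Phiprime_eq_typeSet Ψ _ fun _ => rfl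

/-- The sign dichotomy is injective — from the flip law and the HKS pin alone
(m(true) ∈ {±1} and m(false) = −m(true) are distinct). -/
theorem mSign_injective : Function.Injective A.mSign := by
  intro s t h
  by_contra hne
  have hts : t = !s := by cases s <;> cases t <;> simp_all
  subst hts
  rw [A.mSign_flip s] at h
  rcases A.mSign_unit s with h1 | h1 <;> omega

/-- The inverse m^{−1} of the sign dichotomy on {±1} ([Y1neg] Lemma 3.2 notation,
l. 283–284). -/
def mSignInv (t : ℤ) : Bool := if A.mSign true = t then true else false

/-- m ∘ m^{−1} = id on {±1} (surjectivity of the dichotomy onto {±1}). -/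
theorem mSign_mSignInv (t : ℤ) (ht : t = 1 ∨ t = -1) : A.mSign (A.mSignInv t) = t := by
  have hf : A.mSign false = -(A.mSign true) := by simpa using A.mSign_flip true
  simp only [mSignInv]
  by_cases h : A.mSign true = t
  · rw [if_pos h]; exact h
  · rw [if_neg h]
    rcases A.mSign_unit true with h1 | h1 <;> rcases ht with h2 | h2 <;> omega

/-- **Lemma 3.3(a), second clause at b ≠ ι₁** (l. 283–284): the real signs of W_i are
forced — s_b(W_i) = m^{−1}(m_b(Ψ_i)). -/
theorem C3a_sign (b : B) (hb : b ≠ iota1) : A.sign b = A.mSignInv (mOf Ψ b) := by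
  apply A.mSign_injective
  rw [A.AX3_sign_forced b hb, A.mSign_mSignInv _ (mOf_unit Ψ b), A.mExp_mu_eq]

/-- **Lemma 3.3(a), second clause at ι₁** (l. 283–285): s_{ι₁}(W_i) = ε_hol. -/
theorem C3a_sign_iota1 : A.sign iota1 = A.epsHol := A.AX3_sign_iota1

/-- **Lemma 3.3(a) (lem:allowed(a)), assembled** ([PerL] ll. 280–285): every
irreducible constituent σ of the closure of π_i has Φ′(σ) = Ψ_i, and the real signs
of W_i are forced: s_b(W_i) = m^{−1}(m_b(Ψ_i)) for b ≠ ι₁ and s_{ι₁}(W_i) = ε_hol. -/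
theorem lem_allowed_a (σ : A.Con) :
    Phiprime (L.mExp (A.muOf σ)) = typeSet Ψ ∧
      (∀ b, b ≠ iota1 → A.sign b = A.mSignInv (mOf Ψ b)) ∧
      A.sign iota1 = A.epsHol :=
  ⟨A.C3a_Phiprime σ, fun b hb => A.C3a_sign b hb, A.C3a_sign_iota1⟩

end AllowedDatum

end C3a
end Perl34
/-! # C4 = Lemma 4.2 (lem:chars, [PerL] v5 ll. 526–636) — the Rallis positivity chain

S4 tranche, second target (plan v2 @e3be098b, "C3a + C4" row; hunt (vi) modulo AX7's
print content).  Byte-identical prefix = C3a_Bridge.lean (itself IsolationSetting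
@2def0917 ++ C3a; `cmp`-verified in S4/README.md).

Structure fields = the axiom-group content as consumed (AX6, AX7 + orientation pin,
AX10, AX1b(d), the A4-discharged ramified positivity, the A#11 named summability);
PROVED here (plan A5 + the lem:chars(b) logic): the split unramified Euler factor
Σ_{n∈ℤ} t^{|n|} a^n = (1−t²)/|1−at|² > 0 (t = q^{−3/2}), the exp/log
absolute-convergence bridge HasProd f (exp Σ log f) with its positivity, the
per-place positivity of the unramified tail, ⟨θ_φ(χ′),θ_φ(χ′)⟩ > 0, θ ≠ 0, and the
discharge of the frozen `H_chars` hypothesis (every χ ∈ X allowed). -/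

namespace Perl34
namespace C4

open Complex

/-! ## Plan A5, first half: the split unramified Euler factor (ll. 629–631) -/

/-- The closed form (1−t²)/|1−at|² of the split unramified local factor
I_v(φ⁰_v) = Σ_{n∈ℤ} q_v^{−3|n|/2} a_v^n, with t = q_v^{−3/2} (l. 629–631). -/
noncomputable def eulerFactor (t : ℝ) (a : ℂ) : ℝ :=
  (1 - t ^ 2) / Complex.normSq (1 - a * t)

/-- (no docstring in the 2001 source) -/
theorem norm_mul_ofReal {a : ℂ} (ha : ‖a‖ = 1) {t : ℝ} (ht0 : 0 ≤ t) :
    ‖a * (t : ℂ)‖ = t := by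
  rw [norm_mul, ha, one_mul, Complex.norm_real, Real.norm_eq_abs, abs_of_nonneg ht0]

/-- (no docstring in the 2001 source) -/
theorem one_sub_mul_ne_zero {t : ℝ} (ht0 : 0 ≤ t) (ht1 : t < 1) {a : ℂ} (ha : ‖a‖ = 1) :
    (1 : ℂ) - a * t ≠ 0 := by
  intro h
  have h1 : a * (t : ℂ) = 1 := (sub_eq_zero.mp h).symm
  have h2 : ‖a * (t : ℂ)‖ = t := norm_mul_ofReal ha ht0
  rw [h1, norm_one] at h2
  linarith

/-- (no docstring in the 2001 source) -/
theorem eulerFactor_pos {t : ℝ} (ht0 : 0 ≤ t) (ht1 : t < 1) {a : ℂ} (ha : ‖a‖ = 1) :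
    0 < eulerFactor t a := by
  apply div_pos
  · nlinarith
  · exact Complex.normSq_pos.mpr (one_sub_mul_ne_zero ht0 ht1 ha)

/-- **The A5 identity** ([PerL] l. 629–631): Σ_{n∈ℤ} t^{|n|} aⁿ = (1−t²)/|1−at|² for
|a| = 1 and 0 ≤ t < 1 — two geometric series glued over ℤ, with a⁻¹ = ā. -/
theorem hasSum_eulerFactor {t : ℝ} (ht0 : 0 ≤ t) (ht1 : t < 1) {a : ℂ} (ha : ‖a‖ = 1) :
    HasSum (fun n : ℤ => (t : ℂ) ^ n.natAbs * a ^ n) ((eulerFactor t a : ℝ) : ℂ) := by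
  have hA : (1 : ℂ) - a * t ≠ 0 := one_sub_mul_ne_zero ht0 ht1 ha
  have hconj : (starRingEnd ℂ) ((1 : ℂ) - a * t) = 1 - (starRingEnd ℂ) a * t := by
    simp [map_sub, map_mul, Complex.conj_ofReal]
  have hB : (1 : ℂ) - (starRingEnd ℂ) a * t ≠ 0 := by
    intro h
    apply hA
    have h2 := congrArg (starRingEnd ℂ) h
    rw [map_zero, map_sub, map_one, map_mul, Complex.conj_conj, Complex.conj_ofReal] at h2
    exact h2
  have hna : ‖a * (t : ℂ)‖ < 1 := by rw [norm_mul_ofReal ha ht0]; exact ht1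
  have hac : ‖(starRingEnd ℂ) a‖ = 1 := by rw [RCLike.norm_conj]; exact ha
  have hnc : ‖(starRingEnd ℂ) a * (t : ℂ)‖ < 1 := by
    rw [norm_mul_ofReal hac ht0]; exact ht1
  have ha0 : a ≠ 0 := by intro h; rw [h, norm_zero] at ha; norm_num at ha
  have haa : a * (starRingEnd ℂ) a = 1 := by
    rw [← Complex.inv_eq_conj ha, mul_inv_cancel₀ ha0]
  -- the two geometric halves
  have h1 : HasSum (fun n : ℕ => (t : ℂ) ^ ((n : ℤ)).natAbs * a ^ (n : ℤ))
      ((1 - a * t)⁻¹) := by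
    have he : (fun n : ℕ => (t : ℂ) ^ ((n : ℤ)).natAbs * a ^ (n : ℤ))
        = fun n : ℕ => (a * (t : ℂ)) ^ n := by
      funext n
      have hn : ((n : ℤ)).natAbs = n := by omega
      rw [hn, zpow_natCast, mul_pow]
      ring
    rw [he]
    exact hasSum_geometric_of_norm_lt_one hna
  have h2 : HasSum (fun n : ℕ => (t : ℂ) ^ ((-((n : ℤ) + 1))).natAbs * a ^ (-((n : ℤ) + 1)))
      (((starRingEnd ℂ) a * t) * (1 - (starRingEnd ℂ) a * t)⁻¹) := by
    have he : (fun n : ℕ => (t : ℂ) ^ ((-((n : ℤ) + 1))).natAbs * a ^ (-((n : ℤ) + 1)))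
        = fun n : ℕ => ((starRingEnd ℂ) a * (t : ℂ)) * ((starRingEnd ℂ) a * (t : ℂ)) ^ n := by
      funext n
      have hn : ((-((n : ℤ) + 1))).natAbs = n + 1 := by omega
      have hz : a ^ (-((n : ℤ) + 1)) = ((starRingEnd ℂ) a) ^ (n + 1) := by
        rw [zpow_neg, ← Complex.inv_eq_conj ha, inv_pow]
        norm_cast
      rw [hn, hz]
      ring
    rw [he]
    exact (hasSum_geometric_of_norm_lt_one hnc).mul_left _
  have hsum := HasSum.of_nat_of_neg_add_one
    (f := fun n : ℤ => (t : ℂ) ^ n.natAbs * a ^ n) h1 h2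
  -- identify the value
  have hnum : ((1 : ℂ) - (starRingEnd ℂ) a * t) + ((starRingEnd ℂ) a * t) * ((1 : ℂ) - a * t)
      = 1 - (t : ℂ) ^ 2 := by linear_combination (-(t : ℂ) ^ 2) * haa
  have hABconj : ((1 : ℂ) - a * t) * ((1 : ℂ) - (starRingEnd ℂ) a * t)
      = ((Complex.normSq ((1 : ℂ) - a * t) : ℝ) : ℂ) := by
    rw [← hconj, Complex.mul_conj]
  have id1 : (1 - a * (t : ℂ))⁻¹
        + ((starRingEnd ℂ) a * t) * (1 - (starRingEnd ℂ) a * (t : ℂ))⁻¹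
      = (((1 : ℂ) - (starRingEnd ℂ) a * t) + ((starRingEnd ℂ) a * t) * ((1 : ℂ) - a * t))
        / (((1 : ℂ) - a * t) * ((1 : ℂ) - (starRingEnd ℂ) a * t)) := by
    rw [eq_div_iff (mul_ne_zero hA hB), add_mul]
    have e1 : ((1 : ℂ) - a * t)⁻¹ * (((1 : ℂ) - a * t) * ((1 : ℂ) - (starRingEnd ℂ) a * t))
        = (1 : ℂ) - (starRingEnd ℂ) a * t := by
      rw [← mul_assoc, inv_mul_cancel₀ hA, one_mul]
    have e2 : ((starRingEnd ℂ) a * (t : ℂ)) * ((1 : ℂ) - (starRingEnd ℂ) a * t)⁻¹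
          * (((1 : ℂ) - a * t) * ((1 : ℂ) - (starRingEnd ℂ) a * t))
        = ((starRingEnd ℂ) a * t) * ((1 : ℂ) - a * t) := by
      calc ((starRingEnd ℂ) a * (t : ℂ)) * ((1 : ℂ) - (starRingEnd ℂ) a * t)⁻¹
            * (((1 : ℂ) - a * t) * ((1 : ℂ) - (starRingEnd ℂ) a * t))
          = ((starRingEnd ℂ) a * (t : ℂ)) * ((1 : ℂ) - a * t)
            * (((1 : ℂ) - (starRingEnd ℂ) a * t)⁻¹ * ((1 : ℂ) - (starRingEnd ℂ) a * t)) := by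
            ring
        _ = ((starRingEnd ℂ) a * t) * ((1 : ℂ) - a * t) := by
            rw [inv_mul_cancel₀ hB, mul_one]
    rw [e1, e2]
  have hval : (1 - a * (t : ℂ))⁻¹
        + ((starRingEnd ℂ) a * t) * (1 - (starRingEnd ℂ) a * (t : ℂ))⁻¹
      = ((eulerFactor t a : ℝ) : ℂ) := by
    rw [id1, hnum, hABconj, eulerFactor]
    push_cast
    ring
  rw [hval] at hsum
  exact hsum

/-- The tsum form of the A5 identity. -/
theorem tsum_eulerFactor {t : ℝ} (ht0 : 0 ≤ t) (ht1 : t < 1) {a : ℂ} (ha : ‖a‖ = 1) :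
    ∑' n : ℤ, (t : ℂ) ^ n.natAbs * a ^ n = ((eulerFactor t a : ℝ) : ℂ) :=
  (hasSum_eulerFactor ht0 ht1 ha).tsum_eq

/-- Consumer form: a real number equal (in ℂ) to the split unramified series is the
Euler value — the shape in which `RallisDatum` evaluates its tail factors. -/
theorem eq_eulerFactor_of_ofReal_eq_tsum {t : ℝ} (ht0 : 0 ≤ t) (ht1 : t < 1) {a : ℂ}
    (ha : ‖a‖ = 1) {I : ℝ} (h : (I : ℂ) = ∑' n : ℤ, (t : ℂ) ^ n.natAbs * a ^ n) :
    I = eulerFactor t a := by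
  rw [tsum_eulerFactor ht0 ht1 ha] at h
  exact_mod_cast h

/-! ## Plan A5, second half: absolute convergence ⇒ the tail product is positive -/

/-- The elementary exp/log bridge: strictly positive factors with summable logs have
the product exp(Σ log) — the partial products are exp of the partial sums, and exp
is continuous.  (Consumed with `HasProd.unique` against the AX7 tail field.) -/
theorem hasProd_of_summable_log {ι : Type} {f : ι → ℝ} (hf : ∀ i, 0 < f i)
    (h : Summable fun i => Real.log (f i)) :
    HasProd f (Real.exp (∑' i, Real.log (f i))) := by
  have hs : HasSum (fun i => Real.log (f i)) (∑' i, Real.log (f i)) := h.hasSum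
  have hexp := (Real.continuous_exp.tendsto _).comp hs
  have hcongr : ∀ s : Finset ι,
      Real.exp (∑ i ∈ s, Real.log (f i)) = ∏ i ∈ s, f i := by
    intro s
    rw [Real.exp_sum]
    exact Finset.prod_congr rfl fun i _ => Real.exp_log (hf i)
  exact hexp.congr hcongr

/-- Positivity of any HasProd limit of positive factors with summable logs. -/
theorem pos_of_hasProd_of_summable_log {ι : Type} {f : ι → ℝ} {P : ℝ}
    (hf : ∀ i, 0 < f i) (h : Summable fun i => Real.log (f i)) (hP : HasProd f P) :
    0 < P := by
  have hu := (hasProd_of_summable_log hf h).unique hP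
  rw [← hu]
  exact Real.exp_pos _


-- port_pkg: scope closed for this part
end C4
end Perl34
end HodgeCM.Prior.Perl34File
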